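import Mathlib
import HarnessLib
import HarnessLib.Audit
import Summits.Parity.Statement
import HarnessLib.Audit.Status.Attr

/-!
Route: ParityLeakOneFifth

# Route ParityLeakOneFifth — Pintz-density non-saturation of λ(p+2) feeds the zero-parity-defect
sieve at ν = 1/5

It suffices to show X = E1NonSaturation: for the twin host a_n = Λ'(n) against the z-rough model b_n
= 1[P⁻(n+2) ≥ z]/V(z) on n ∈ (x, 2x]
(z = exp((log log x)²)), the ONE Type-II functional W_Φ = Σ Φ(n+2)(a_n − b_n) that the
Harman/Ford–Maynard lower-bound sieve consumes at
(γ, θ, ν) = (1/2, 0, 1/5) with the (W1) weight (which collapses to μ(d) on {d ≤ x^{1/2−2ε}, p | d ⇒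
p ≥ x^{1/5}}) stays a factor (1 − η) below
its parity-line value Π = Σ b_n λ(n+2) Φ(n+2). Because the (W1) weight has ZERO parity defect at ν =
1/5, X gives π₂(x) ≫ x/log²x (T =
TwinLowerDensity, via the unconditional crux ParityLeakSieve), and X itself splits EXACTLY (crux
PlainSplit) into a plain density statement
K1 = PintzDensity (Σ_{x<p≤2x} log p·λ(p+2) ≤ κx, some κ < 1) and a calibrated, parity-line-blind
Type-II member K2 = CalibratedE1. The
GHL-complement of T is the declared residual R = TwinLowerDensityToGHL (shared node with the sibling
sketch parity-weighted-chen-switching).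
Realises card parity-leak-one-fifth (mwave sketch 54e515b4a7, readers PASS N4 R3 A4 T4).
Lean: `E1NonSaturation ∧ TwinLowerDensityToGHL`

## Assembly
The unconditional sieve-theoretic core is S1 ∘ S2: PlainSplit turns (CalibratedE1, PintzDensity)
into X = E1NonSaturation and ParityLeakSieve turns X into T = TwinLowerDensity; the
declared residual TwinLowerDensityToGHL turns T into the Statement. The Assembly item records
exactly the composite "K1 ∧ K2 ∧ R ⟹ GHL" (provable from S1 and S2, NOT by pure logic), and
the deciding theorem uses it: `closes h₁ h₂ h₃ h₄ h₅ := (Assembly from h₃, h₄) h₁ h₂ h₅` (glue.lean,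
certified natively: ok, every item in the cone of `closes`).

Rationale: WHY THIS LINE. Bombieri's asymptotic sieve (Bombieri1976) and Selberg's examples say a sieve fed
Type-I data plus Type-II data blind to λ cannot see twins; Ford–Maynard (FordMaynard2024,
arXiv:2407.14368 Thm 2.7) make
this quantitative: at level 1/2 the lower-bound sieve constant C⁻(1/2, 0, ν) is positive iff ν >
0.1663, and at ν = 1/5 the Duke–Friedlander–Iwaniec corner gives C⁻ = 0.362 (Harman2007 §14). The
new move is
to run the sieve exactly at ν = 1/5, where the (W1) weight's parity defect D vanishes, and to split
its single consumed functional along Bombieri's parity line b(1 + tλ): the calibrated member K2 is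
identically zero on the whole parity line (so it is NOT a parity statement), and the entire parity
content becomes the plain density statement K1 — Pintz's problem (Pintz2015; Lichtman2020 §1;
MurtyVatwani2017 for the nearest printed reduction, which instead needs EH and Möbius CANCELLATION
in progressions). Imported: prime-detecting-sieve technology (Harman's comparison principle, FM
linear
programming), multiplicative number theory for λ on shifted multiplication tables (Type-II-for-λ,
cf. the hub's LiouvilleMAD), Bombieri–Vinogradov and the fundamental lemma (tree theorems). What no
prior
route does: make a DENSITY form of "Ω(p+2) odd for a positive proportion of primes" load-bearing
toward twin primes; negatives index (3 entries) untouched.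

RANKED CRUXES. #0 E1NonSaturation (target) — X — non-saturation of the sieve's one consumed Type-II
functional at ν = 1/5: for some η > 0, all small ε and large x, W_Φ ≤ (1 − η)·Π (all objects inline:
z, V(z), b, a = Λ', the (W1)@1/5 type function Φ on m = n+2 with least prime factor in [x^{ε²},
x^{1/5})). (why it might fail: it is implied by HL but could fail only through a conspiracy placing
twins' whole sieve deficit on the m = pℓ types with p < x^{1/5}; as typed it inherits K1's and K2's
risks.) [FordMaynard2024, Harman2007, Bombieri1976]
#0 TwinLowerDensity (target) — T — twin primes have positive lower density on the Hardy–Littlewood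
scale: π₂(x) ≥ c·x/log²x for some c > 0 and all large x (shared node with the sibling sketch
parity-weighted-chen-switching; reached here only through ParityLeakSieve, never staffed directly).
(why it might fail: it is the twin prime conjecture in density form (open); on this route it is
reached only via X.) [HalberstamRichert1974, FordMaynard2024]
#2 PintzDensity (crux) — K1 (deciding, the parity input as a DENSITY): there is κ < 1 with
Σ_{x<p≤2x} log p · λ(p+2) ≤ κ·x for all large x — i.e. Ω(p+2) is odd for a positive (log-weighted)
proportion of the primes in every dyadic window (Pintz's problem in density form; any κ < 1
suffices). [difficulty: open-problem] (why it might fail: true under HL/Chowla but it IS the parity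
bit: no Type-I method can give it (Bombieri's host b(1+λ) saturates); its suppliers (Type-II for λ
below x^0.17 via FM Thm 2.7(b), log-density/energy routes) are all open.) [Pintz2015, Lichtman2020,
arXiv:2407.14368, MurtyVatwani2017]
#3 CalibratedE1 (crux) — K2 (hardest; Type-II species, parity-line blind): with t₁ = Π/B the exact
calibration (same b, Φ), the functional W_Φ − t₁·W_λ (W_λ = Σ λ(n+2)(a_n − b_n)) is ≤ θ·x/log x for
every θ > 0, all ε ≤ ε₁ and x ≥ x₀(ε, θ); it vanishes identically on Bombieri's parity line a = b(1
+ tλ(n+2)). [difficulty: open-problem] (why it might fail: no Type-II-species theorem for shifted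
primes exists (Harman §14.2); modulo E1-asymptotics K2 contains the LOWER-sided Pintz inequality,
and a twin-poor host off the parity line with level-1/2 Type-I data would violate it.) [Harman2007,
arXiv:2407.14368, BFI1986, DukeFriedlanderIwaniec1997]
#4 TwinLowerDensityToGHL (crux) — R (declared RESIDUAL, GHL-hard): positive lower density of twin
primes implies the Generalized Hardy–Littlewood statement — i.e. everything in GHL beyond the
conjunct T (pair asymptotics at all shifts, k ≥ 3, affine systems; shared node with the sibling
sketch). [difficulty: open-problem] (why it might fail: it cannot fail to be true if GHL is, but it
is summit-hard: T is a lower bound ≤ 0.362·HL and nothing in R is reachable from it; declared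
residual, parked openly.) [GreenTao2010, FordMaynard2024]
#5 ParityLeakSieve (crux) — S2 (unconditional, XL): E1NonSaturation → TwinLowerDensity — the (W1)
lower-bound sieve at (1/2, 0, 1/5) for the twin host: comparison principle + model evaluation + BV
(class −2) + fundamental lemma + Jurkat–Richert strip bounds give Σ_{twins in (x,2x]} log n ≥ (1 −
η)Π − W_Φ − o(Π), and Π ≥ c₀x/log x with c₀ ∝ 𝔠(1/5) = 1 − 2M₃(1/5) = 0.362 > 0 (zero parity defect
at ν = 1/5). [difficulty: XL] (why it might fail: only by a bookkeeping error in the claimed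
identity D(W1) = 0 at ν = 1/5 or in the sign analysis of the (W1) weight on composite types; every
analytic input (BV, FL, JR bounds, Buchstab) is a tree theorem.) [arXiv:2407.14368, Harman2007,
HalberstamRichert1974, JurkatRichert1965, Bombieri1965]
#6 PlainSplit (crux) — S1 (unconditional, L): CalibratedE1 → PintzDensity → E1NonSaturation — the
three-line split W_Φ = [W_Φ − t₁W_λ] + t₁W_λ with t₁ = Π/B: K2 bounds the bracket by θx/log x, K1
plus the model-mass asymptotics (B ∼ x, Σ b λ(n+2) = o(x): FL + BV/Siegel–Walfisz for λ) bound W_λ ≤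
(κ + o(1))x, and Π ≥ c₀x/log x makes θ := c₀(1−κ)/3 admissible. [deps: PintzDensity, CalibratedE1]
[difficulty: L] (why it might fail: needs Π ≥ c₀x/log x (a model computation with PNT-level inputs)
and Σ_n b_n λ(n+2) = o(x) at level z^O(1) = x^o(1) (FL sandwich + BV-λ, tree); fails only if the
calibration lower bound were mis-evaluated.) [Bombieri1976, arXiv:2407.14368, HalberstamRichert1974]

TWO-LAYER PLAN. Foreseen glued splits (registered as BC3 birth skeletons, nothing filed now):
PintzDensity ⇐ TypeIILiouvilleLopsided → (TypeIILiouvilleLopsided → PintzDensity) [Ford–Maynard Thm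
2.7(b) on the bounded
host (1 − λ(n+2))/2; the Type-II statement is implied by LiouvilleMAD's TypeIILiouville, c = 2];
CalibratedE1 ⇐ CalibratedE1Low (window [x^{ε²}, x^{1/14}): β-sieve majorant + BFI Thm 10 at level
4/7)
→ CalibratedE1High (window [x^{1/14}, x^{1/5}): the research core) → split; PlainSplit ⇐
ModelMassAsymptotics → CalibrationLowerBound → assemble; ParityLeakSieve ⇐ MasterInequality →
CalibrationLowerBound → (DyadicLogTwins → TwinLowerDensity); TwinLowerDensityToGHL ⇐ ShiftedPairsHL
→ (ShiftedPairsHL → GHL) [= the hub's shared PairsHL / PairsToGHL nodes].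

KILL CRITERIA. Refutation of ParityLeakSieve (a twin-free host with level-1/2 Type-I data whose
kernel passes the master inequality) or of PlainSplit closes the route outright (close --reason
refuted:<Decl>): the
mechanism would be wrong. Refutation of CalibratedE1 AS TYPED (e.g. a proof that K2 fails for the
true twin host, or that K2 ↔ lower-Pintz given E1-asymptotics makes it parity-complete) forces a
pivot to the band-local member (LogPintz / BandLocalSplit of the sketch) or retirement; refutation
of PintzDensity would refute Chowla/HL themselves (sensational; route moot). A proof elsewhere of
TwinLowerDensity (any c > 0) moots cruxes 2, 3, 5, 6 and leaves only the residual.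

NOT DECOMPOSED YET. The sieve constant 𝔠(1/5) = 0.36217 and M₃(1/5) < 1/2 (a certified 1-D integral)
live inside ParityLeakSieve's proof, not in any item (all items are constant-free: η, c, c₀, κ
existential). The
E1-asymptotics (Π ∼ 𝔠·𝔖(z)x/log x), the Buchstab/Dickman evaluation of Π by type, the FL/BV
bookkeeping and the dyadic-to-cumulative step are layer-2 stubs of the registered skeletons. No
Type-II supplier for K1 (TypeIILiouvilleLopsided) and no low-band theorem for K2 is filed as an
item: they are skeleton stubs until a crux closes.

CHEAPEST FALSIFIER. (a) Re-derive D(W1) = 0 at ν = 1/5 and the three-line split (paper level; two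
independent numerics give ∫π du = 0.36217); (b) certify `CalibratedE1 ↔ lower-Pintz` modulo
E1-asymptotics (fixes the
grade of K2, does not kill the reduction); (c) numerics of x⁻¹Σ_{x<p≤2x} log p·λ(p+2) and of #{p ∼ x
: Ω(p+2) odd}/π up to 10¹⁰ (expect ≈ 0 and ≈ 1/2); (d) try to build a twin-free host with level-1/2
Type-I data passing BOTH members (by the master inequality none exists — a construction refutes
ParityLeakSieve). Run here: BC2/BC3/BC4/BC7 probes (all clean, see Novelty) — no in-Lean falsifier
bites.

NUMBERS. C⁻(1/2, 0, 1/5) = 𝔠(1/5) = 1 − 2M₃(1/5) = 0.36217 (FordMaynard2024 Thm 2.7 / DFI corner;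
sketch folder, interval arithmetic); ν₀(1/2) = 0.1663 (FM Thm 2.1: below it C⁻ = 0); Type-II window
for
K1's supplier: N ∈ [x^ε, x^0.17]; low/high band cut for K2: 1/14 (BFI1986 Thm 10 level 4/7 = 1/2 +
1/14); z = exp((log log x)²); all item constants existential (η, κ < 1, c, c₀, θ universal).

DEFINITION REQUESTS. None needed to state the items (all over Mathlib:
ArithmeticFunction.liouville/moebius, Nat.minFac, Nat.divisors, Finset sums; and the tree's
Literature.NumberTheory.Sieve.twinPrimeCount /
GeneralizedHardyLittlewood). Cite fact wanted after open (not for `closes`): "fact: FordMaynard2024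
Thm 2.7(b) — for bounded sequences C⁻_𝔅(1/2−ε, ε, ν−2ε; ϱ) > 0 for ν ≥ 0.1663" (supplier
edge TypeIILiouvilleLopsided → PintzDensity of the K1 skeleton).

Novelty: Searches (2026-08-17, sketch seat + this seat; corpus fts+vec and galaxy): `lit search "Murty
Vatwani twin primes parity problem"` → [corpus:arxiv-2009.08969 p.20], [corpus:arxiv-2005.03811
p.3,11], [corpus:arxiv-2111.08912 p.12],
zbMATH doi:10.1016/j.jnt.2017.05.011; `lit search --hybrid "positive proportion of primes p such
that p+2 has an odd number of prime factors Liouville"` → elementary books only, no statement hit;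
`lit vsearch "the
Liouville function of p+2 is negative for a positive proportion of primes"` → 1 unrelated; `lit
search "Möbius function shifted primes"` → [corpus:arxiv-2009.08969], [corpus:arxiv-2206.12956],
[corpus:arxiv-2406.05217];
`lit search "prime-detecting sieves Harman Type II information"` →
[corpus:book:harman2007-prime-detecting-sieves p.286]; `lit search "Ford Maynard theory of prime
producing sieves"` → [corpus:arxiv-2407.14368],
[corpus:arxiv-2504.13195], [corpus:arxiv-2410.04189]; `lit galaxy search "parity problem|Liouville
function at shifted primes" --star all` → 0 relevant; `lit galaxy search … --star pdf --mode
intelligent` →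
[galaxy:pdf:9125150009983760040] (Murty, twin primes après Zhang), [galaxy:pdf:-4779781982134597260]
(Polymath retrospective), [galaxy:pdf:-7415298198939735120] (Pintz), [galaxy:pdf:3333917200]
(Granville) — no
hit for "positive density of primes with λ(p±2) = −1 as a sieve INPUT" in corpus(fts+vec) and
galaxy; `lean search` (LambdaLiouvilleLevel, TypeIILiouville, MoebiusShiftedPrimesConjecture,
lichtman2020, Pai  [refs: 10.1016/j.jnt.2017.05.011, 2407.14368, arxiv-2009.08969, arxiv-2005.03811, arxiv-2111.08912, doi:10.1016/j.jnt.2017.05.011, arxiv-2206.12956, arxiv-2406.05217, book:harman2007-prime-detecting-sieves, arxiv-2407.14368, arxiv-2504.13195, arxiv-2410.04189, FordMaynard2024, DukeFriedlanderIwaniec1997, MurtyVatwani2017, Pintz2015, Lichtman2020]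

Barriers (technique_class: harman-fm-sieve, calibrated-parity-split, liouville-II): - technique_class: harman-fm-sieve, calibrated-parity-split, liouville-II
- Literature.Barriers.Parity.SelbergParityBarrier: PintzDensity is exactly the bit the barrier
leaves undecided and is DECLARED as the parity input (never claimed from Type-I data; Bombieri's
host b(1+λ) shows κ = 1 is attained by parity-blind data); CalibratedE1 ≡ 0 on the whole parity line
by construction, so the barrier's indistinguishable pair does not separate it;
ParityLeakSieve/PlainSplit are identities/inequalities valid for every host.
- Literature.Barriers.Parity.PrimePairParity: the weight-insertion symmetry forbids
insertion-invariant PROOFS of twins; K1 is not insertion-invariant (fails on b(1+λ)), K2 is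
invariant only along the parity line — consistent; the route's twin output is conditional on K1.
- Literature.Barriers.Parity.FordMaynardMinimalTypeII: the sieve runs at ν = 1/5 > ν₀(1/2) = 0.1663
where C⁻ > 0 is FM Thm 2.7 itself — the prime-free (I)+(II) hosts of Thm 2.1 do not exist at this
width; the Thm 6.3 prime-poor pattern hosts at smaller ν are what K2 ∧ K1 must and do exclude
(stated content, not evaded); K1's supplier window [x^ε, x^0.17] is inside the theorem's positive
range for bounded hosts (FordMaynardLowLevel likewise not engaged: level 1/2, not a low level).
- Literature.Barriers.Parity.LogarithmicAveraging: no log-to-natural density upgrade is attempted;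
K1 is a natural-density statement at every large scale, and the sketch records that an unbounded set
of scales would su

sub-problem: GeneralizedHardyLittlewood · status: open · opened planner-type-54e515b4a7-0 2026-08-17T16:24:54Z · rev 0 · ledger route-Parity-ParityLeakOneFifth
GENERATED by the gate from the ledger (D-0016/17). Provers cite these decls: `theorem foo : Summit.Parity.GeneralizedHardyLittlewood.Theses.ParityLeakOneFifth.<Decl> := …` in Summits/Parity/GeneralizedHardyLittlewood/Theorems/<Name>.lean.
-/

namespace Summit.Parity.GeneralizedHardyLittlewood.Theses.ParityLeakOneFifth

open scoped BigOperators Topology Manifold Classical MeasureTheory ProbabilityTheory Matrix InnerProductSpace ComplexConjugate ContinuousMap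
open Filter Set Function TopologicalSpace MeasureTheory

attribute [summit_statement] _root_.GeneralizedHardyLittlewood

/-- item stmt-Parity-18376 · target · rank 0 · open · by planner
why it might fail: it is implied by HL but could fail only through a conspiracy placing twins' whole sieve deficit on the m = pℓ types with p < x^{1/5}; as typed it inherits K1's and K2's risks.
sources: FordMaynard2024, Harman2007, Bombieri1976
[target] X — non-saturation of the sieve's one consumed Type-II functional at ν = 1/5: for some η >
0, all small ε and large x, W_Φ ≤ (1 − η)·Π (all objects inline: z, V(z), b, a = Λ', the (W1)@1/5
type function Φ on m = n+2 with least prime factor in [x^{ε²}, x^{1/5})). -/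
@[route_item "route-Parity-ParityLeakOneFifth"]
def E1NonSaturation : Prop :=
  ∃ η : ℝ, 0 < η ∧ ∃ ε₁ : ℝ, 0 < ε₁ ∧ ∀ ε : ℝ, 0 < ε → ε ≤ ε₁ → ∃ x₀ : ℕ, ∀ x : ℕ, x₀ ≤ x → let z : ℝ := Real.exp (Real.log (Real.log (x : ℝ)) ^ 2); let V : ℝ := ∏ p ∈ (Finset.range ⌈z⌉₊).filter Nat.Prime, (1 - 1 / (p : ℝ)); let b : ℕ → ℝ := fun n => if ∀ p ∈ n.primeFactors, z ≤ (p : ℝ) then 1 / V else 0; let a : ℕ → ℝ := fun n => if n.Prime then Real.log (n : ℝ) else 0; let Φ : ℕ → ℝ := fun m => if (x : ℝ) ^ (ε ^ 2) ≤ (m.minFac : ℝ) ∧ (m.minFac : ℝ) < (x : ℝ) ^ ((1 : ℝ) / 5) then ∑ d ∈ (Nat.divisors m).filter (fun d : ℕ => (d : ℝ) ≤ (x : ℝ) ^ ((1 : ℝ) / 2 - 2 * ε) ∧ ∀ p ∈ d.primeFactors, (x : ℝ) ^ ((1 : ℝ) / 5) ≤ (p : ℝ)), (ArithmeticFunction.moebius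 d : ℝ) else 0; (∑ n ∈ Finset.Ioc x (2 * x), Φ (n + 2) * (a n - b n)) ≤ (1 - η) * ∑ n ∈ Finset.Ioc x (2 * x), b n * (ArithmeticFunction.liouville (n + 2) : ℝ) * Φ (n + 2)

/-- item stmt-Parity-18377 · target · rank 0 · open · by planner
why it might fail: it is the twin prime conjecture in density form (open); on this route it is reached only via X.
sources: HalberstamRichert1974, FordMaynard2024
[target] T — twin primes have positive lower density on the Hardy–Littlewood scale: π₂(x) ≥
c·x/log²x for some c > 0 and all large x (shared node with the sibling sketch
parity-weighted-chen-switching; reached here only through ParityLeakSieve, never staffed directly). -/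
@[route_item "route-Parity-ParityLeakOneFifth"]
def TwinLowerDensity : Prop :=
  ∃ c : ℝ, 0 < c ∧ ∃ x₀ : ℕ, ∀ x : ℕ, x₀ ≤ x → c * (x : ℝ) / Real.log (x : ℝ) ^ 2 ≤ (Literature.NumberTheory.Sieve.twinPrimeCount x : ℝ)

/-- item stmt-Parity-18378 · crux · rank 2 · open · by planner
why it might fail: true under HL/Chowla but it IS the parity bit: no Type-I method can give it (Bombieri's host b(1+λ) saturates); its suppliers (Type-II for λ below x^0.17 via FM Thm 2.7(b), log-density/energy routes) are all open.
sources: Pintz2015, Lichtman2020, arXiv:2407.14368, MurtyVatwani2017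
[crux] K1 (deciding, the parity input as a DENSITY): there is κ < 1 with Σ_{x<p≤2x} log p · λ(p+2) ≤
κ·x for all large x — i.e. Ω(p+2) is odd for a positive (log-weighted) proportion of the primes in
every dyadic window (Pintz's problem in density form; any κ < 1 suffices). [difficulty:
open-problem] -/
@[route_item "route-Parity-ParityLeakOneFifth", crux]
def PintzDensity : Prop :=
  ∃ κ : ℝ, κ < 1 ∧ ∃ x₀ : ℕ, ∀ x : ℕ, x₀ ≤ x → ∑ p ∈ (Finset.Ioc x (2 * x)).filter Nat.Prime, Real.log (p : ℝ) * (ArithmeticFunction.liouville (p + 2) : ℝ) ≤ κ * (x : ℝ)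

/-- item stmt-Parity-18379 · crux · rank 3 · open · by planner
why it might fail: no Type-II-species theorem for shifted primes exists (Harman §14.2); modulo E1-asymptotics K2 contains the LOWER-sided Pintz inequality, and a twin-poor host off the parity line with level-1/2 Type-I data would violate it.
sources: Harman2007, arXiv:2407.14368, BFI1986, DukeFriedlanderIwaniec1997
[crux] K2 (hardest; Type-II species, parity-line blind): with t₁ = Π/B the exact calibration (same
b, Φ), the functional W_Φ − t₁·W_λ (W_λ = Σ λ(n+2)(a_n − b_n)) is ≤ θ·x/log x for every θ > 0, all ε
≤ ε₁ and x ≥ x₀(ε, θ); it vanishes identically on Bombieri's parity line a = b(1 + tλ(n+2)).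
[difficulty: open-problem] -/
@[route_item "route-Parity-ParityLeakOneFifth", crux]
def CalibratedE1 : Prop :=
  ∃ ε₁ : ℝ, 0 < ε₁ ∧ ∀ ε : ℝ, 0 < ε → ε ≤ ε₁ → ∀ θ : ℝ, 0 < θ → ∃ x₀ : ℕ, ∀ x : ℕ, x₀ ≤ x → let z : ℝ := Real.exp (Real.log (Real.log (x : ℝ)) ^ 2); let V : ℝ := ∏ p ∈ (Finset.range ⌈z⌉₊).filter Nat.Prime, (1 - 1 / (p : ℝ)); let b : ℕ → ℝ := fun n => if ∀ p ∈ n.primeFactors, z ≤ (p : ℝ) then 1 / V else 0; let a : ℕ → ℝ := fun n => if n.Prime then Real.log (n : ℝ) else 0; let Φ : ℕ → ℝ := fun m => if (x : ℝ) ^ (ε ^ 2) ≤ (m.minFac : ℝ) ∧ (m.minFac : ℝ) < (x : ℝ) ^ ((1 : ℝ) / 5) then ∑ d ∈ (Nat.divisors m).filter (fun d : ℕ => (d : ℝ) ≤ (x : ℝ) ^ ((1 : ℝ) / 2 - 2 * ε) ∧ ∀ p ∈ d.primeFactors, (x : ℝ) ^ ((1 : ℝ) / 5) ≤ (p : ℝ)),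 (ArithmeticFunction.moebius d : ℝ) else 0; (∑ n ∈ Finset.Ioc x (2 * x), Φ (n + 2) * (a n - b n)) - (∑ n ∈ Finset.Ioc x (2 * x), b n * (ArithmeticFunction.liouville (n + 2) : ℝ) * Φ (n + 2)) / (∑ n ∈ Finset.Ioc x (2 * x), b n) * (∑ n ∈ Finset.Ioc x (2 * x), (ArithmeticFunction.liouville (n + 2) : ℝ) * (a n - b n)) ≤ θ * (x : ℝ) / Real.log (x : ℝ)

/-- item stmt-Parity-18380 · crux · rank 4 · open · by planner
why it might fail: it cannot fail to be true if GHL is, but it is summit-hard: T is a lower bound ≤ 0.362·HL and nothing in R is reachable from it; declared residual, parked openly.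
sources: GreenTao2010, FordMaynard2024
[crux] R (declared RESIDUAL, GHL-hard): positive lower density of twin primes implies the
Generalized Hardy–Littlewood statement — i.e. everything in GHL beyond the conjunct T (pair
asymptotics at all shifts, k ≥ 3, affine systems; shared node with the sibling sketch). [difficulty:
open-problem] -/
@[route_item "route-Parity-ParityLeakOneFifth", crux]
def TwinLowerDensityToGHL : Prop :=
  TwinLowerDensity → GeneralizedHardyLittlewood

/-- item stmt-Parity-18381 · crux · rank 5 · closed · proved by Summit.Parity.GeneralizedHardyLittlewood.Theorems.ParityLeakOneFifth.parityLeakSieve (prover) · by planner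
why it might fail: only by a bookkeeping error in the claimed identity D(W1) = 0 at ν = 1/5 or in the sign analysis of the (W1) weight on composite types; every analytic input (BV, FL, JR bounds, Buchstab) is a tree theorem.
sources: arXiv:2407.14368, Harman2007, HalberstamRichert1974, JurkatRichert1965, Bombieri1965
[crux] S2 (unconditional, XL): E1NonSaturation → TwinLowerDensity — the (W1) lower-bound sieve at
(1/2, 0, 1/5) for the twin host: comparison principle + model evaluation + BV (class −2) +
fundamental lemma + Jurkat–Richert strip bounds give Σ_{twins in (x,2x]} log n ≥ (1 − η)Π − W_Φ −
o(Π), and Π ≥ c₀x/log x with c₀ ∝ 𝔠(1/5) = 1 − 2M₃(1/5) = 0.362 > 0 (zero parity defect at ν = 1/5).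
[difficulty: XL] -/
@[route_item "route-Parity-ParityLeakOneFifth", crux]
def ParityLeakSieve : Prop :=
  E1NonSaturation → TwinLowerDensity

-- `ParityLeakSieve` holds: proved by `Summit.Parity.GeneralizedHardyLittlewood.Theorems.ParityLeakOneFifth.parityLeakSieve` (its module imports this route file, so no `_holds` link can be stated here).

/-- item stmt-Parity-18382 · crux · rank 6 · closed · proved by Summit.Parity.GeneralizedHardyLittlewood.Theorems.ParityLeakOneFifth.plainSplit (prover) · by planner
why it might fail: needs Π ≥ c₀x/log x (a model computation with PNT-level inputs) and Σ_n b_n λ(n+2) = o(x) at level z^O(1) = x^o(1) (FL sandwich + BV-λ, tree); fails only if the calibration lower bound were mis-evaluated.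
sources: Bombieri1976, arXiv:2407.14368, HalberstamRichert1974
[crux] S1 (unconditional, L): CalibratedE1 → PintzDensity → E1NonSaturation — the three-line split
W_Φ = [W_Φ − t₁W_λ] + t₁W_λ with t₁ = Π/B: K2 bounds the bracket by θx/log x, K1 plus the model-mass
asymptotics (B ∼ x, Σ b λ(n+2) = o(x): FL + BV/Siegel–Walfisz for λ) bound W_λ ≤ (κ + o(1))x, and Π
≥ c₀x/log x makes θ := c₀(1−κ)/3 admissible. [deps: PintzDensity, CalibratedE1] [difficulty: L] -/
@[route_item "route-Parity-ParityLeakOneFifth", crux]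
def PlainSplit : Prop :=
  CalibratedE1 → PintzDensity → E1NonSaturation

-- `PlainSplit` holds: proved by `Summit.Parity.GeneralizedHardyLittlewood.Theorems.ParityLeakOneFifth.plainSplit` (its module imports this route file, so no `_holds` link can be stated here).

/-- item stmt-Parity-18383 · assembly · rank 1 · open · by planner
sources: arXiv:2407.14368, Bombieri1976
[assembly] PintzDensity → CalibratedE1 → TwinLowerDensityToGHL → GeneralizedHardyLittlewood — the
two analytic cruxes and the residual suffice (content: PlainSplit and ParityLeakSieve composed;
proved inside `closes` from h₃, h₄). -/
@[route_item "route-Parity-ParityLeakOneFifth"]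
def Assembly : Prop :=
  PintzDensity → CalibratedE1 → TwinLowerDensityToGHL → GeneralizedHardyLittlewood

/-! D-0027 §2.1 — DECIDING THEOREM (planner-authored via `route open/edit --closes-file`; by planner-type-54e515b4a7-0 2026-08-17T16:24:54Z):
its hypotheses are this route's items and its conclusion the sub-problem Statement (glue_lint), and it elaborates with this file. -/

@[closes "route-Parity-ParityLeakOneFifth"] theorem closes (h₁ : PintzDensity) (h₂ : CalibratedE1) (h₃ : PlainSplit) (h₄ : ParityLeakSieve)
    (h₅ : TwinLowerDensityToGHL) : GeneralizedHardyLittlewood := by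
  have hA : Assembly := by
    intro k₁ k₂ r
    exact r (h₄ (h₃ k₂ k₁))
  exact hA h₁ h₂ h₅

end Summit.Parity.GeneralizedHardyLittlewood.Theses.ParityLeakOneFifth
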